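import Mathlib

/-!
# SoloInformed — the null-spike deviation table (CAPS.md §3, CONSTRUCTION B)

Soloist `solo-FinalStateConjecture-informed`, session 26.  Pure Minkowski algebra behind
CONSTRUCTION B of `paper/CAPS.md`: in `E^{1,3}` with coordinates `(T; X, Y, Z)` put
`e ψ = cosh ψ ∂_T + sinh ψ ∂_Z`, `u ψ = sinh ψ ∂_T + cosh ψ ∂_Z`, `ℓ = ∂_T + ∂_Z` (null).  The map
`Ψ(σ,x) = W(σ) + x¹∂_X + x²∂_Y + x³ u(ψ σ) + δ₀ s(x) ℓ` (with `W' = e ∘ ψ`) has frame images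
`∂_σ ↦ (1 + x³ψ') e ψ`, `∂_a ↦ ∂_a + δ₀ (∂_a s) ℓ` (`a = 1,2`), `∂_3 ↦ u ψ`.  We certify the table of
pullback deviations `h = Ψ^*η − η`:
`h_σσ = 1 − (1+x³ψ')²`, `h_σa = −δ₀ s_a (1+x³ψ') e^{−ψ}`, `h_σ3 = 0`, `h_ab = 0` (`a ≠ b`), `h_aa = 0`,
`h_a3 = δ₀ s_a e^{−ψ}`, `h_33 = 0`; the redshift `δ₀ e^{−ψ} → 0`; the obstruction for a non-null
pitch (`h_aa = (δ₀ s_a)² ⟨D,D⟩`); and the reach identity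
`−⟨b + jc ℓ, b + jc ℓ⟩ = −⟨b,b⟩ + 2jc (b_T − b_Z) → +∞`.
NOT certified here (and not claimed): that `Ψ` composed with the covering map is an embedding into an
actual vacuum development, or anything about `FinalStateDecomposition`; see CAPS.md §3 for those steps.
-/

set_option linter.dupNamespace false

noncomputable section

namespace Summit.FinalStateConjecture.FinalStateConjecture.Theorems
namespace SoloInformedNullSpike

open Filter Topology

/-- A vector of `ℝ^{1,3}` written in coordinates `(T; X, Y, Z)`. -/
structure V4 where
  t : ℝ
  x : ℝ
  y : ℝ
  z : ℝ

namespace V4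

/-- Sum of two vectors. -/
def add (v w : V4) : V4 := ⟨v.t + w.t, v.x + w.x, v.y + w.y, v.z + w.z⟩

/-- Scalar multiple. -/
def smul (c : ℝ) (v : V4) : V4 := ⟨c * v.t, c * v.x, c * v.y, c * v.z⟩

/-- The Minkowski pairing `η = diag(−1,1,1,1)`. -/
def mink (v w : V4) : ℝ := -(v.t * w.t) + v.x * w.x + v.y * w.y + v.z * w.z

end V4

open V4

/-- The boosted unit timelike vector `e ψ = cosh ψ ∂_T + sinh ψ ∂_Z`. -/
def e (ψ : ℝ) : V4 := ⟨Real.cosh ψ, 0, 0, Real.sinh ψ⟩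

/-- The boosted unit spacelike vector `u ψ = sinh ψ ∂_T + cosh ψ ∂_Z`. -/
def u (ψ : ℝ) : V4 := ⟨Real.sinh ψ, 0, 0, Real.cosh ψ⟩

/-- The null pitch direction `ℓ = ∂_T + ∂_Z`. -/
def ell : V4 := ⟨1, 0, 0, 1⟩

/-- `∂_X`. -/
def ex : V4 := ⟨0, 1, 0, 0⟩

/-- `∂_Y`. -/
def ey : V4 := ⟨0, 0, 1, 0⟩

/-! ## The basic pairings -/

/-- `e ψ` is unit timelike. -/
theorem mink_e_e (ψ : ℝ) : mink (e ψ) (e ψ) = -1 := by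
  have h := Real.cosh_sq_sub_sinh_sq ψ
  simp only [mink, e]
  nlinarith [h]

/-- `u ψ` is unit spacelike. -/
theorem mink_u_u (ψ : ℝ) : mink (u ψ) (u ψ) = 1 := by
  have h := Real.cosh_sq_sub_sinh_sq ψ
  simp only [mink, u]
  nlinarith [h]

/-- `e ψ ⊥ u ψ`. -/
theorem mink_e_u (ψ : ℝ) : mink (e ψ) (u ψ) = 0 := by
  simp only [mink, e, u]; ring

/-- The pitch direction `ℓ` is null. -/
theorem mink_ell_ell : mink ell ell = 0 := by
  simp [mink, ell]

/-- `ℓ ⊥ ∂_X`. -/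
theorem mink_ell_ex : mink ell ex = 0 := by
  simp [mink, ell, ex]

/-- `ℓ ⊥ ∂_Y`. -/
theorem mink_ell_ey : mink ell ey = 0 := by
  simp [mink, ell, ey]

/-- The redshift of the null pitch in the boosted frame: `⟨ℓ, e ψ⟩ = −e^{−ψ}`. -/
theorem mink_ell_e (ψ : ℝ) : mink ell (e ψ) = -Real.exp (-ψ) := by
  have h := Real.cosh_sub_sinh ψ
  simp only [mink, ell, e]
  linarith

/-- `⟨ℓ, u ψ⟩ = e^{−ψ}`. -/
theorem mink_ell_u (ψ : ℝ) : mink ell (u ψ) = Real.exp (-ψ) := by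
  have h := Real.cosh_sub_sinh ψ
  simp only [mink, ell, u]
  linarith

/-! ## The frame images of `Ψ` and the deviation table -/

/-- Image of `∂_σ`: `(1 + x³ψ') e ψ`. -/
def Fσ (ψ dψ x3 : ℝ) : V4 := smul (1 + x3 * dψ) (e ψ)

/-- Image of `∂_1`: `∂_X + δ₀ s₁ ℓ`. -/
def F1 (δ₀ s1 : ℝ) : V4 := add ex (smul (δ₀ * s1) ell)

/-- Image of `∂_2`: `∂_Y + δ₀ s₂ ℓ`. -/
def F2 (δ₀ s2 : ℝ) : V4 := add ey (smul (δ₀ * s2) ell)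

/-- Image of `∂_3`: `u ψ`. -/
def F3 (ψ : ℝ) : V4 := u ψ

/-- `h_σσ = ⟨Fσ,Fσ⟩ − η_σσ = 1 − (1 + x³ψ')²` (Born-rigid acceleration cost only). -/
theorem h_σσ (ψ dψ x3 : ℝ) :
    mink (Fσ ψ dψ x3) (Fσ ψ dψ x3) - (-1) = 1 - (1 + x3 * dψ) ^ 2 := by
  have h := Real.cosh_sq_sub_sinh_sq ψ
  simp only [mink, Fσ, smul, e]
  nlinarith [h]

/-- `h_σ1 = −δ₀ s₁ (1 + x³ψ') e^{−ψ}`: the null pitch is redshifted. -/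
theorem h_σ1 (ψ dψ x3 δ₀ s1 : ℝ) :
    mink (Fσ ψ dψ x3) (F1 δ₀ s1) = -(δ₀ * s1) * (1 + x3 * dψ) * Real.exp (-ψ) := by
  have h := Real.cosh_sub_sinh ψ
  simp only [mink, Fσ, F1, smul, add, e, ex, ell]
  rw [← h]; ring

/-- `h_σ2 = −δ₀ s₂ (1 + x³ψ') e^{−ψ}`. -/
theorem h_σ2 (ψ dψ x3 δ₀ s2 : ℝ) :
    mink (Fσ ψ dψ x3) (F2 δ₀ s2) = -(δ₀ * s2) * (1 + x3 * dψ) * Real.exp (-ψ) := by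
  have h := Real.cosh_sub_sinh ψ
  simp only [mink, Fσ, F2, smul, add, e, ey, ell]
  rw [← h]; ring

/-- `h_σ3 = 0`. -/
theorem h_σ3 (ψ dψ x3 : ℝ) : mink (Fσ ψ dψ x3) (F3 ψ) = 0 := by
  simp only [mink, Fσ, F3, smul, e, u]; ring

/-- `h_11 = 0` EXACTLY: the pitch is null and orthogonal to `∂_X`. -/
theorem h_11 (δ₀ s1 : ℝ) : mink (F1 δ₀ s1) (F1 δ₀ s1) - 1 = 0 := by
  simp only [mink, F1, smul, add, ex, ell]; ring

/-- `h_22 = 0`. -/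
theorem h_22 (δ₀ s2 : ℝ) : mink (F2 δ₀ s2) (F2 δ₀ s2) - 1 = 0 := by
  simp only [mink, F2, smul, add, ey, ell]; ring

/-- `h_12 = 0`. -/
theorem h_12 (δ₀ s1 s2 : ℝ) : mink (F1 δ₀ s1) (F2 δ₀ s2) = 0 := by
  simp only [mink, F1, F2, smul, add, ex, ey, ell]; ring

/-- `h_13 = δ₀ s₁ e^{−ψ}`. -/
theorem h_13 (ψ δ₀ s1 : ℝ) : mink (F1 δ₀ s1) (F3 ψ) = δ₀ * s1 * Real.exp (-ψ) := by
  have h := Real.cosh_sub_sinh ψ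
  simp only [mink, F1, F3, smul, add, ex, ell, u]
  rw [← h]; ring

/-- `h_23 = δ₀ s₂ e^{−ψ}`. -/
theorem h_23 (ψ δ₀ s2 : ℝ) : mink (F2 δ₀ s2) (F3 ψ) = δ₀ * s2 * Real.exp (-ψ) := by
  have h := Real.cosh_sub_sinh ψ
  simp only [mink, F2, F3, smul, add, ey, ell, u]
  rw [← h]; ring

/-- `h_33 = 0`. -/
theorem h_33 (ψ : ℝ) : mink (F3 ψ) (F3 ψ) - 1 = 0 := by
  have := mink_u_u ψ
  simp only [F3]; linarith

/-- `Ψ_*∂_σ` is timelike (future orientation is the sign of its `T`-component, `(1+x³ψ') cosh ψ > 0`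
when `1 + x³ψ' > 0`). -/
theorem Fσ_timelike (ψ dψ x3 : ℝ) (hx : 1 + x3 * dψ ≠ 0) :
    mink (Fσ ψ dψ x3) (Fσ ψ dψ x3) < 0 := by
  have h := h_σσ ψ dψ x3
  have hsq : 0 < (1 + x3 * dψ) ^ 2 := by positivity
  linarith

/-- `Ψ_*∂_σ` is future-pointing (`T`-component positive) when `1 + x³ψ' > 0`. -/
theorem Fσ_future (ψ dψ x3 : ℝ) (hx : 0 < 1 + x3 * dψ) : 0 < (Fσ ψ dψ x3).t := by
  simp only [Fσ, smul, e]
  exact mul_pos hx (Real.cosh_pos ψ)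

/-! ## The redshift tends to zero, so every entry of the table does (for fixed `δ₀`, `s_a`
bounded, and `x³ψ' → 0`). -/

/-- The redshift factor `δ₀ e^{−ψ} → 0` as the rapidity `ψ → ∞`. -/
theorem tendsto_redshift (δ₀ : ℝ) :
    Tendsto (fun ψ : ℝ => δ₀ * Real.exp (-ψ)) atTop (𝓝 0) := by
  have h := Real.tendsto_exp_neg_atTop_nhds_zero.const_mul δ₀
  simpa using h

/-! ## Why the pitch must be null: for a general pitch direction `D ⊥ ∂_X` the diagonal entry is
`h_11 = (δ₀ s₁)² ⟨D,D⟩`, independent of the boost — it vanishes iff `D` is null (or `δ₀ s₁ = 0`). -/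

/-- Non-null pitch obstruction: `h_11 = (δ₀ s₁)² ⟨D,D⟩` for any pitch direction `D ⊥ ∂_X`. -/
theorem h_11_general (D : V4) (hD : D.x = 0) (δ₀ s1 : ℝ) :
    mink (add ex (smul (δ₀ * s1) D)) (add ex (smul (δ₀ * s1) D)) - 1 = (δ₀ * s1) ^ 2 * mink D D := by
  simp only [mink, add, smul, ex, hD]; ring

/-! ## Reach: the coils string out along the null line `b + ℝ₊ ℓ`, and the Milne time squared
`−⟨p,p⟩` grows linearly without bound when `b_T > b_Z`. -/

/-- Position of the `j`-th coil (up to `O(1)`): `p = b + (j c) ℓ`. -/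
def coil (b : V4) (c j : ℝ) : V4 := add b (smul (j * c) ell)

/-- Milne time squared of the `j`-th coil: `−⟨b + jcℓ, b + jcℓ⟩ = −⟨b,b⟩ + 2jc(b_T − b_Z)`. -/
theorem milne_sq_coil (b : V4) (c j : ℝ) :
    -(mink (coil b c j) (coil b c j)) = -(mink b b) + 2 * (j * c) * (b.t - b.z) := by
  simp only [mink, coil, add, smul, ell]; ring

/-- The Milne time squared of the coils tends to `+∞` along the null line when `c > 0` and `b_T > b_Z`:
every slab image of the spike reaches cosmological time `+∞`. -/
theorem tendsto_milne_sq_coil (b : V4) (c : ℝ) (hc : 0 < c) (hb : b.z < b.t) :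
    Tendsto (fun j : ℝ => -(mink (coil b c j) (coil b c j))) atTop atTop := by
  have hk : 0 < 2 * c * (b.t - b.z) := by
    have : 0 < b.t - b.z := sub_pos.mpr hb
    positivity
  have h1 : Tendsto (fun j : ℝ => j * (2 * c * (b.t - b.z))) atTop atTop :=
    tendsto_id.atTop_mul_const hk
  have h2 : Tendsto (fun j : ℝ => -(mink b b) + j * (2 * c * (b.t - b.z))) atTop atTop :=
    tendsto_atTop_add_const_left _ _ h1
  refine h2.congr' (Eventually.of_forall fun j => ?_)
  show -(mink b b) + j * (2 * c * (b.t - b.z)) = -(mink (coil b c j) (coil b c j))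
  rw [milne_sq_coil]; ring

/-- Along the base worldline `W' = e ψ` the quantity `T − Z` has derivative `e^{−ψ} > 0`
(so it stays positive and `milne_sq_coil` applies at every later time). -/
theorem e_t_sub_z (ψ : ℝ) : (e ψ).t - (e ψ).z = Real.exp (-ψ) := by
  simp only [e]; exact Real.cosh_sub_sinh ψ

/-- Hence `T − Z` increases along the base worldline. -/
theorem e_t_sub_z_pos (ψ : ℝ) : 0 < (e ψ).t - (e ψ).z := by
  rw [e_t_sub_z]; exact Real.exp_pos _

end SoloInformedNullSpike
end Summit.FinalStateConjecture.FinalStateConjecture.Theorems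

end
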